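import Mathlib
import Literature.Analysis.FluidPDE.KNSSMildCompactness
import Summits.NavierStokesRegularity.OSWSelfSimilar.TypeIIInnerLimitCaseA
import HarnessLib
/-!
# (I-2) extraction WITH convergence, and the (I-3)/(I-4) dichotomy from pre-limit data alone (zone Z1 TEMPLATE §T1.4-I, kernel)

HONEST FRAMING (cell ns-blowup GROUP B «PROFILE SEARCH», zone Z1; D-0035/D-0074): part XIX of the Z1 dictionary. Parts XV
(Case B) and XVIII (Case A) took the CONVERGENCE of the zoom as a hypothesis, because the tree's discharge of KNSS 2009
Prop. 6.1 (`KNSS2009_blowup_generates_ancient_holds`) is by the constant witness and never tied the limit to the zoom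
(§T1.25 (K31) «HONEST RESIDUE»). The rate-free Lemma 6.1 is now a tree theorem (this seat:
`Literature.Analysis.FluidPDE.KNSS2009_lemma61_of_oseenMild`, `…_ancientMild_of_oseenMild`,
`isKNSSBlowupLimit_of_oseenMild_zoom_vertex` in `KNSSMildCompactness`), so the residue is discharged: from PRE-LIMIT data
only — classical Oseen-mild zoom fields on `(A_k, B_k)`, `A_k → −∞`, bounded by `1` up to the vertex time, with
`‖w⁽ᵏ⁾(0, 0)‖ → 1` (the TEMPLATE's gauge N-a normalisation at running-max times) — a subsequence converges slice-wise
locally uniformly to a KNSS blow-up limit. This file reads that on the dictionary: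

* `innerLimit_exists_of_zoom` — **(I-2) EXTRACTION, KERNEL**: the inner object EXISTS as an `IsKNSSBlowupLimit` together
  with the locally uniform convergence of a subsequence of the zoom;
* `innerLimit_const_of_recedingAxis_zoom` — **Case B from pre-limit data**: if moreover the zoom slices are axisymmetric
  about vertical axes through `−M_k e₀` with `M_k → ∞`, the extracted inner object is constant in space on every slice
  (part XV) — NO conjecture, NO convergence hypothesis;
* `innerLimit_const_of_axisCentred_zoom_under_axisymmetricLiouville` — **Case A from pre-limit data, under (AX-L)**: for the
  axis-centred zoom `y ↦ λₙ • v(tₙ + λₙ² s, xₙ* + λₙ • y)` of an axisymmetric classical solution under K8's standing lifespan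
  hypotheses (Oseen-mild as zoom fields, bounded by `1` up to the vertex, `‖·(0,0)‖ → 1`), IF
  `Summit.NavierStokesRegularity.NavierStokesRegularity.AxisymmetricLiouvilleBoundedSwirl` holds the extracted inner object is
  constant in space (parts XII/XVI/XVIII).

So, by decl: «the TEMPLATE's type-(β) inner object requires ¬(AX-L)», with hypotheses ONLY on the pre-limit solution and
its zoom. **Nothing here asserts that a blow-up occurs or that (AX-L) holds or fails.** «violates: n/a — dictionary»;
bears_on LADDER-NS N5/Z1 → N1 linear core / N0⁻ ((I-2)/(I-3)/(I-4)). Author: ns-blowup-profile-eng-1 g7, 2026-08-27.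
-/

open Real Filter Topology Set MeasureTheory Function
open Literature.Analysis.FluidPDE

namespace Summit.NavierStokesRegularity.OSWSelfSimilar
namespace TypeIIModulationDictionary

section Extraction

variable {A B : ℕ → ℝ} {w : ℕ → ℝ → EuclideanSpace ℝ (Fin 3) → EuclideanSpace ℝ (Fin 3)}
  {q : ℕ → ℝ → EuclideanSpace ℝ (Fin 3) → ℝ}

/-- **TEMPLATE (I-2) EXTRACTION, KERNEL** (KNSS 2009 Lemma 6.1 + Prop. 6.1 with convergence; the tree's
`isKNSSBlowupLimit_of_oseenMild_zoom_vertex`): classical Oseen-mild zoom fields `w⁽ᵏ⁾` on `(A_k, B_k)`, `A_k → −∞`,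
`B_k > 0`, bounded by `1` on `(A_k, 0] × ℝ³` with `‖w⁽ᵏ⁾(0, 0)‖ → 1`, have a subsequence converging slice-wise locally
uniformly at every `s < 0` to an inner object `W` which is a KNSS blow-up limit (`IsKNSSBlowupLimit`: smooth bounded
ancient mild, duality class, `|W| ≤ 1 = sup |W|`). [new here — dictionary] -/
theorem innerLimit_exists_of_zoom (hAlim : Tendsto A atTop atBot) (hBpos : ∀ k, 0 < B k)
    (hw : ∀ k, IsClassicalNSSolutionOn (Ioo (A k) (B k)) 1 0 (w k) (q k))
    (hmild : ∀ k, ∀ s t : ℝ, A k < s → s < t → t < B k → ∀ x,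
      w k t x = Literature.Analysis.UnboundedOperators.heatExtension (w k s) (t - s) x - oseenDuhamel 1 s (w k) (w k) t x)
    (hbd : ∀ k, ∀ τ ∈ Ioc (A k) 0, ∀ x, ‖w k τ x‖ ≤ 1)
    (hvert : Tendsto (fun k => ‖w k 0 0‖) atTop (𝓝 1)) :
    ∃ (φ : ℕ → ℕ) (W : ℝ → EuclideanSpace ℝ (Fin 3) → EuclideanSpace ℝ (Fin 3)), StrictMono φ ∧
      IsKNSSBlowupLimit W ∧ ∀ s < 0, TendstoLocallyUniformly (fun k => w (φ k) s) (W s) atTop :=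
  isKNSSBlowupLimit_of_oseenMild_zoom_vertex hAlim hBpos hw hmild hbd hvert

/-- **Case B from pre-limit data (TEMPLATE (I-3)), no conjecture**: if the zoom fields of `innerLimit_exists_of_zoom` are
moreover axisymmetric, slice by slice, about the vertical axes through `−M_k e₀` with `M_k → ∞` (the max-centred zoom with
`d_k → ∞`, `zoom_rot_about`), then the extracted inner object is CONSTANT IN SPACE on every slice (part XV
`knssBlowupLimit_apply_eq_of_receding_axis` along the subsequence) — hence of type (I-4)(α). [new here — dictionary] -/
theorem innerLimit_const_of_recedingAxis_zoom (hAlim : Tendsto A atTop atBot) (hBpos : ∀ k, 0 < B k)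
    (hw : ∀ k, IsClassicalNSSolutionOn (Ioo (A k) (B k)) 1 0 (w k) (q k))
    (hmild : ∀ k, ∀ s t : ℝ, A k < s → s < t → t < B k → ∀ x,
      w k t x = Literature.Analysis.UnboundedOperators.heatExtension (w k s) (t - s) x - oseenDuhamel 1 s (w k) (w k) t x)
    (hbd : ∀ k, ∀ τ ∈ Ioc (A k) 0, ∀ x, ‖w k τ x‖ ≤ 1)
    (hvert : Tendsto (fun k => ‖w k 0 0‖) atTop (𝓝 1))
    {M : ℕ → ℝ} (hM : Tendsto M atTop atTop)
    (hsym : ∀ k, ∀ s < 0, ∀ (θ : ℝ) (y : EuclideanSpace ℝ (Fin 3)),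
      w k s (EuclideanSpace.single 0 (-M k) + rotZ θ (y - EuclideanSpace.single 0 (-M k))) = rotZ θ (w k s y)) :
    ∃ (φ : ℕ → ℕ) (W : ℝ → EuclideanSpace ℝ (Fin 3) → EuclideanSpace ℝ (Fin 3)), StrictMono φ ∧
      IsKNSSBlowupLimit W ∧ (∀ s < 0, TendstoLocallyUniformly (fun k => w (φ k) s) (W s) atTop) ∧
      ∀ s < 0, ∀ y : EuclideanSpace ℝ (Fin 3), W s y = W s 0 := by
  obtain ⟨φ, W, hφ, hW, hconv⟩ := innerLimit_exists_of_zoom hAlim hBpos hw hmild hbd hvert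
  refine ⟨φ, W, hφ, hW, hconv, ?_⟩
  exact knssBlowupLimit_apply_eq_of_receding_axis (V := fun k => w (φ k)) (hM.comp hφ.tendsto_atTop)
    (fun k s hs θ y => hsym (φ k) s hs θ y) hconv hW

variable {T ν Mₛ : ℝ} {v : ℝ → EuclideanSpace ℝ (Fin 3) → EuclideanSpace ℝ (Fin 3)}
  {p : ℝ → EuclideanSpace ℝ (Fin 3) → ℝ}

/-- **Case A from pre-limit data, under (AX-L) (TEMPLATE (I-2)/(I-3)/(I-4), gauge (G1) with the centre on the axis).**
Let `v` satisfy K8's standing lifespan hypotheses (classical unforced NS on `[0, T⋆)`, `ν > 0`, axisymmetric, bounded on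
closed sub-slabs, `|Γ₀| ≤ Mₛ`), and let the axis-centred zoom `w⁽ᵏ⁾(s, y) = λₖ • v(tₖ + λₖ² s, xₖ* + λₖ • y)` (`tₖ → T⋆`,
`tₖ < T⋆`, `λₖ → 0`, `xₖ*` on the axis) be classical Oseen-mild fields on `(A_k, B_k)`, `A_k → −∞`, bounded by `1` up to
the vertex with `‖w⁽ᵏ⁾(0, 0)‖ → 1`. IF `Summit.NavierStokesRegularity.NavierStokesRegularity.AxisymmetricLiouvilleBoundedSwirl`
holds, then the extracted inner object is constant in space on every slice: extraction (this file) + axisymmetry and the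
swirl bound of the limit from the zoom (part XVIII along the subsequence) + (AX-L) (part XVI). [new here — dictionary] -/
theorem innerLimit_const_of_axisCentred_zoom_under_axisymmetricLiouville
    (hAXL : Summit.NavierStokesRegularity.NavierStokesRegularity.AxisymmetricLiouvilleBoundedSwirl)
    (hν : 0 < ν) (hT : 0 < T)
    (hcl : IsClassicalNSSolutionOn (Ico 0 T) ν 0 v p) (haxi : ∀ t ∈ Ico 0 T, IsAxisymmetric (v t))
    (hbdd : ∀ T' < T, ∃ V₀ : ℝ, ∀ t ∈ Icc 0 T', ∀ x, ‖v t x‖ ≤ V₀) (hMₛ : ∀ x, |swirl (v 0) x| ≤ Mₛ)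
    {tn lamn : ℕ → ℝ} {xcn : ℕ → EuclideanSpace ℝ (Fin 3)} (htT : Tendsto tn atTop (𝓝 T))
    (hlt : ∀ n, tn n < T) (hlam : Tendsto lamn atTop (𝓝 0)) (hxc : ∀ n, xcn n 0 = 0 ∧ xcn n 1 = 0)
    (hzoom : ∀ k s y, w k s y = lamn k • v (tn k + lamn k ^ 2 * s) (xcn k + lamn k • y))
    (hAlim : Tendsto A atTop atBot) (hBpos : ∀ k, 0 < B k)
    (hw : ∀ k, IsClassicalNSSolutionOn (Ioo (A k) (B k)) 1 0 (w k) (q k))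
    (hmild : ∀ k, ∀ s t : ℝ, A k < s → s < t → t < B k → ∀ x,
      w k t x = Literature.Analysis.UnboundedOperators.heatExtension (w k s) (t - s) x - oseenDuhamel 1 s (w k) (w k) t x)
    (hbd : ∀ k, ∀ τ ∈ Ioc (A k) 0, ∀ x, ‖w k τ x‖ ≤ 1)
    (hvert : Tendsto (fun k => ‖w k 0 0‖) atTop (𝓝 1)) :
    ∃ (φ : ℕ → ℕ) (W : ℝ → EuclideanSpace ℝ (Fin 3) → EuclideanSpace ℝ (Fin 3)), StrictMono φ ∧
      IsKNSSBlowupLimit W ∧ (∀ s < 0, TendstoLocallyUniformly (fun k => w (φ k) s) (W s) atTop) ∧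
      ∀ s < 0, ∀ y : EuclideanSpace ℝ (Fin 3), W s y = W s 0 := by
  obtain ⟨φ, W, hφ, hW, hconv⟩ := innerLimit_exists_of_zoom hAlim hBpos hw hmild hbd hvert
  refine ⟨φ, W, hφ, hW, hconv, ?_⟩
  -- pointwise convergence of the axis-centred zoom along the subsequence
  have hlim : ∀ s < 0, ∀ y, Tendsto (fun n => lamn (φ n) • v (tn (φ n) + lamn (φ n) ^ 2 * s)
      (xcn (φ n) + lamn (φ n) • y)) atTop (𝓝 (W s y)) := by
    intro s hs y
    have h := ((hconv s hs).tendstoLocallyUniformlyOn (s := univ)).tendsto_at (mem_univ y)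
    exact h.congr fun n => hzoom (φ n) s y
  exact innerLimit_apply_eq_of_axisCentred_zoom_under_axisymmetricLiouville hAXL hν hT hcl haxi hbdd hMₛ
    (htT.comp hφ.tendsto_atTop) (fun n => hlt (φ n)) (hlam.comp hφ.tendsto_atTop) (fun n => hxc (φ n)) hlim hW

end Extraction

end TypeIIModulationDictionary
end Summit.NavierStokesRegularity.OSWSelfSimilar
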